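import Summits.PneNP.PneNP.Theorems.ConvexRankGatesConvexGateBlindExactLiftingTrianglePlaneLocalAdd

/-!
# Triangle instance — plane-local factorisations: the additive coupling condition passes to minors

Support file for crux `ConvexGateBlind` (stmt-PneNP-10680), open stub `stub_exactLifting` (prover seat 3, session 15);
sequel of `…TrianglePlaneLocalAdd` (`AddSolves`).
Deleting a row `a` and a column `d` from every atom of a dictionary that satisfies `AddSolves` on the `(t+1) × (t+1)` grid
gives a dictionary satisfying `AddSolves` on the `t × t` grid (`triangle_planeLocal_minor`, registered stub): a pair `(P,S)`
of the minor is extended by putting `a ∉ P`, `d ∉ S` (`Fin.insertNth`), and the solution restricts.  Atoms supported inside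
the deleted cross restrict to zero, so `m_+(t+1) ≥ m_+(t) + (number of atoms inside some cross)`; in particular `m_+` is
monotone (memo `PLANELOCAL-seat3.md` §7).  Nothing here is cited; everything is elementary.
-/

set_option linter.dupNamespace false -- `Summit.PneNP.PneNP.…`: summit = sub-problem (D-0017)

namespace Summit.PneNP.PneNP.Theorems.XorDoor.TriLine

open Finset

variable {t : ℕ}

/-- The minor of a dictionary: delete row `a` and column `d` from every atom. -/
theorem addSolves_minor {ι : Type} [Fintype ι] {H : ι → Fin (t + 1) → Fin (t + 1) → ℝ} (a d : Fin (t + 1))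
    (hA : AddSolves H) : AddSolves (fun i x y => H i (a.succAbove x) (d.succAbove y)) := by
  intro P S hP₁ hP₂ hS₁ hS₂
  obtain ⟨x₁, hx₁⟩ := hP₁
  obtain ⟨y₁, hy₁⟩ := hS₁
  -- extend the pair: the deleted row and column go to the complement
  set P' : Fin (t + 1) → Bool := Fin.insertNth a false P with hP'
  set S' : Fin (t + 1) → Bool := Fin.insertNth d false S with hS'
  have hP'a : P' a = false := by simp [hP']
  have hS'd : S' d = false := by simp [hS']
  have hP's : ∀ x, P' (a.succAbove x) = P x := fun x => by simp [hP']
  have hS's : ∀ y, S' (d.succAbove y) = S y := fun y => by simp [hS']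
  obtain ⟨c₀, c₁, α, β, hc₀, hc₁, hadd, hαP, hαN, hβP, hβN, hdomB, hdomC⟩ :=
    hA P' S' ⟨a.succAbove x₁, by rw [hP's]; exact hx₁⟩ ⟨a, hP'a⟩ ⟨d.succAbove y₁, by rw [hS's]; exact hy₁⟩ ⟨d, hS'd⟩
  refine ⟨c₀, c₁, fun x => α (a.succAbove x), fun y => β (d.succAbove y), hc₀, hc₁, fun x y => hadd _ _,
    fun x hx => hαP _ (by rw [hP's]; exact hx), fun x hx => hαN _ (by rw [hP's]; exact hx),
    fun y hy => hβP _ (by rw [hS's]; exact hy), fun y hy => hβN _ (by rw [hS's]; exact hy),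
    fun x y hx hy => hdomB _ _ (by rw [hP's]; exact hx) (by rw [hS's]; exact hy),
    fun x y hx hy => hdomC _ _ (by rw [hP's]; exact hx) (by rw [hS's]; exact hy)⟩

/-- Registered form (stub `triangle_planeLocal_minor` of stmt-PneNP-10680): `AddSolves` passes to the minor obtained by
deleting one row and one column from every atom. -/
theorem triangle_planeLocal_minor : ∀ {t : ℕ} {ι : Type} [Fintype ι] {H : ι → Fin (t + 1) → Fin (t + 1) → ℝ} (a d : Fin (t + 1)), AddSolves H → AddSolves (fun i x y => H i (a.succAbove x) (d.succAbove y)) :=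
  fun a d hA => addSolves_minor a d hA

end Summit.PneNP.PneNP.Theorems.XorDoor.TriLine
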